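import Literature.Computability.AlgebraicComplexity.MS08Obstructions
import Literature.Computability.AlgebraicComplexity.KempfNessSelfAdjointStabilizer
import Literature.RepresentationTheory.AlgebraicGroups.SelfAdjointGroupReductive
import HarnessLib

/-!
# GCT II, Prop. 5.1 and the «only if» half of Thm. 1.8 (a): irreducibles occurring in `R_V[v]`
# are `G_v̂`-admissible (Mulmuley–Sohoni 2008, §5), with Matsushima's theorem for forms

Companion (THEOREMS ONLY: no definition, no named fact; D-0026) of
`Literature/Computability/AlgebraicComplexity/MS08Obstructions.lean` (K. D. Mulmuley, M. Sohoni,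
*Geometric complexity theory II: towards explicit obstructions for embeddings among class
varieties*, SIAM J. Comput. **38** (2008) [bib `MulmuleySohoniGCT2SIAM2008`]; TeX of record
`pub-gct/inputs/files/src/cs_0612134/main.tex`, journal § = e-print § − 1), which vendors
**Thm. 1.8 (a)** («If `v ∈ P(V)` is stable, an irreducible `G`-module `V_λ(G)` … can occur in
`R_V[v]` iff `V_λ(G)` is `G_v̂`-admissible», main.tex L478–487) in the tree's special case
`G = SL_σ(ℂ)`, `V = Sym^m ℂ^σ` as the NAMED FACT `MS08_thm_1_8a` (open; printed proof: Props. 5.1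
+ 5.2 with Matsushima's theorem and the algebraic Peter–Weyl theorem, L1099–1174).

## What is here (all proved)

* § 1 `exists_ne_zero_invariant_of_invariant_functional` — the step «Weyl's theorem on complete
  decomposibility of `H`-modules into irreducibles implies that the existence of an `H`-invariant is
  equivalent to existence of an `H`-coinvariant» (L1109–1112): on a completely reducible module a
  non-zero invariant functional yields a non-zero invariant vector.
* § 2 **`MS08_prop_5_1` — Prop. 5.1 AS PRINTED** (main.tex L1099–1108, `\label{pstableorb}`):
  «Let `h ∈ P(V)` be a point such that the stabilizer `H = G_ĥ` of `ĥ ∈ V` is reductive. Then every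
  irreducible `G`-module occurring in `R[h]` must be `H`-admissible; i.e., must contain a nonzero
  `H`-invariant. If `G_ĥ` is not reductive, this still holds if `H` is any reductive subgroup of
  `G_ĥ`.» Rendered for `G = SL_σ(ℂ)` acting on forms `h` of degree `m` by linear substitution,
  `R[h]_d = ℂ[Δ[h]]_d` (`orbitCoordRepDeg`), a `G`-module given as the restriction of a
  representation `ρ` of `GL_σ(ℂ)`, «occurring» = a non-zero `SL`-intertwiner into some `R[h]_d`
  (exactly the vocabulary of `MS08_thm_1_8a`), `H` ANY subgroup of `SL_σ(ℂ) ∩ G_ĥ` (second sentence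
  of the proposition), and «reductive» entering, as in the printed proof, ONLY through Weyl's
  theorem for the `H`-module at hand: hypothesis `(ρ|_H).IsSemisimpleRepresentation` (Goodman–Wallach
  Def. 3.3.1 defines «reductive» as «every regular representation is completely reducible»; the
  statement proved is therefore Prop. 5.1 with its reductivity hypothesis weakened to the instance
  the proof uses). Proof as printed: Prop. 4.2 (the tree's `exists_evalAtPoint_ne_zero`,
  `evalAtPoint_orbitCoordRep_of_eq_smul`: evaluation at `ĥ` is a non-zero `H`-invariant functional
  on the image) + § 1.
* § 3 **Matsushima's theorem for forms** `isSemisimpleRepresentation_comp_stabilizer_of_isPolystable`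
  («Since `v` is stable, `G_v̂` is reductive [harish, matsushima]», L1125–1127, L1169–1171): for a
  POLYSTABLE form `v` (closed `SL`-orbit, the tree's `IsPolystable`) the restriction to
  `SL_σ(ℂ) ∩ G_v̂` (`slSubgroup σ ℂ ⊓ linStabilizer v`) of every finite-dimensional rational
  representation of `GL_σ(ℂ)` is completely reducible. Route (not the printed citation): by
  `KempfNessSelfAdjointStabilizer.lean` some `SL`-translate `w = g₀ · v` has a stabiliser closed
  under `h ↦ hᴴ`; that stabiliser is an algebraic (`isAlgebraicSubgroup_slSubgroup_inf_linStabilizer`)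
  self-adjoint subgroup of `GL_σ(ℂ)`, hence reductive by the tree's
  `AlgebraicGroups.isSemisimpleRepresentation_of_star_mem` (Goodman–Wallach Thm. 3.3.15, unitarian
  trick + Zariski density of the unitary points); conjugate back by `g₀`.
* § 4 **`MS08_thm_1_8a_mp` — the «only if» half of Thm. 1.8 (a), UNCONDITIONAL** in the exact
  binders of `MS08_thm_1_8a`: for `v` polystable, a rational `ρ` (irreducibility is not needed for
  this direction) occurring in some `R_V[v]_d` is `(SL ∩ G_v̂)`-admissible. And the bookkeeping
  reduction `MS08_thm_1_8a_of_prop_5_2`: the named fact now follows from (is equivalent to) its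
  «if» half, Prop. 5.2 (L1119–1168: orbit `G v̂ ≅ G/H` + algebraic Peter–Weyl), which stays OPEN —
  no named fact is introduced for it.

Honest framing: bookkeeping of a published representation-theoretic statement at the level of
generality the tree speaks; the named fact `MS08_thm_1_8a` is NOT discharged (its «if» half is
open in the tree); nothing here is progress on VP versus VNP or on any GCT conjecture.

## References

* [MulmuleySohoniGCT2SIAM2008] K. D. Mulmuley, M. Sohoni, *Geometric complexity theory II*,
  SIAM J. Comput. 38 (2008) 1175–1206; arXiv cs/0612134: Thm. 2.8 (a) = journal Thm. 1.8 (a)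
  (main.tex L478–487), Props. 6.1–6.2 = journal Props. 5.1–5.2 (L1099–1174), Prop. 5.2 = journal
  Prop. 4.2 (L1041–1077).
* [GoodmanWallachGTM255] R. Goodman, N. R. Wallach, *Symmetry, Representations, and Invariants*,
  GTM 255 (2009), Def. 3.3.1, Thm. 3.3.15 (through `SelfAdjointGroupReductive.lean`).
* [KempfNess1979] G. Kempf, L. Ness, *The length of vectors in representation spaces*, LNM 732
  (1979) (through `KempfNessSelfAdjointStabilizer.lean`).
* Y. Matsushima, *Espaces homogènes de Stein des groupes de Lie complexes*, Nagoya Math. J. 16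
  (1960) 205–218 (the theorem replaced here by the Kempf–Ness route).

## Provenance

Cell `val-lit` (HOME `run/shared/lean/pub/val-lit/`), seat `val-lit-t02` generation 6 (GCT II
lineage; registry claim `MS08_thm_1_8a`, PARTIAL «only if» half).
-/

noncomputable section

open MvPolynomial Representation
open scoped Matrix
open Literature.NumberTheory.Automorphic (GLCoord glCoordFun IsAlgebraicSubgroup zeroLocusGL)
open Literature.NumberTheory.DiophantineGeometry (IsRationalRep)
open Literature.RepresentationTheory.AlgebraicGroups (isSemisimpleRepresentation_of_star_mem
  isAlgebraicSubgroup_of_mem_iff_det_eq_one det_star_eq_one)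

namespace Literature.Computability.AlgebraicComplexity

universe u

/-! ### § 1 Weyl's step: invariant functional ⇒ invariant vector on a completely reducible module -/

section Weyl

variable {G : Type*} [Group G] {V : Type u} [AddCommGroup V] [Module ℂ V]

/-- `IsCompl` of subrepresentations gives `IsCompl` of the underlying submodules. [folklore] -/
private theorem isCompl_toSubmodule_of_isCompl' {τ : Representation ℂ G V}
    {T T' : Subrepresentation τ} (h : IsCompl T T') : IsCompl T.toSubmodule T'.toSubmodule := by
  rw [isCompl_iff, disjoint_iff, codisjoint_iff] at h ⊢
  exact ⟨by rw [← Subrepresentation.toSubmodule_inf, h.1]; rfl,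
    by rw [← Subrepresentation.toSubmodule_sup, h.2]; rfl⟩

/-- `IsCompl` for subrepresentations is `IsCompl` of the underlying submodules. [folklore] -/
private theorem isCompl_of_isCompl_toSubmodule' {τ : Representation ℂ G V}
    {T T' : Subrepresentation τ} (h : IsCompl T.toSubmodule T'.toSubmodule) : IsCompl T T' := by
  rw [isCompl_iff, disjoint_iff, codisjoint_iff] at h ⊢
  exact ⟨Subrepresentation.toSubmodule_injective (by rw [Subrepresentation.toSubmodule_inf]; exact h.1),
    Subrepresentation.toSubmodule_injective (by rw [Subrepresentation.toSubmodule_sup]; exact h.2)⟩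

/-- **Invariants from coinvariants under complete reducibility** (Mulmuley–Sohoni 2008, proof of
Prop. 5.1, main.tex L1109–1112: «Weyl's theorem on complete decomposibility of `H`-modules into
irreducibles implies that the existence of an `H`-invariant is equivalent to existence of an
`H`-coinvariant»; also Def. 4.1, L1014–1018): if `τ` is completely reducible and `φ ≠ 0` is a
`τ`-invariant linear functional, then `τ` has a non-zero invariant vector — a `τ`-stable complement
of `ker φ` is a non-zero subspace of fixed vectors.
[cite: MulmuleySohoniGCT2SIAM2008, Prop. 5.1 proof (arXiv cs/0612134 Prop. 6.1, main.tex L1109–1112)] -/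
theorem exists_ne_zero_invariant_of_invariant_functional (τ : Representation ℂ G V)
    (hss : τ.IsSemisimpleRepresentation) (φ : V →ₗ[ℂ] ℂ) (hφ : φ ≠ 0)
    (hinv : ∀ (g : G) (x : V), φ (τ g x) = φ x) : ∃ v : V, v ≠ 0 ∧ ∀ g : G, τ g v = v := by
  let K : Subrepresentation τ :=
    ⟨LinearMap.ker φ, fun g v hv => by
      rw [LinearMap.mem_ker] at hv ⊢
      rw [hinv, hv]⟩
  obtain ⟨C, hKC⟩ := hss.exists_isCompl K
  have hKC' : IsCompl (LinearMap.ker φ) C.toSubmodule := isCompl_toSubmodule_of_isCompl' hKC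
  have hCne : C.toSubmodule ≠ ⊥ := by
    intro hC
    apply hφ
    have hK : LinearMap.ker φ = ⊤ := by
      have := hKC'.sup_eq_top
      rwa [hC, sup_bot_eq] at this
    exact LinearMap.ker_eq_top.mp hK
  obtain ⟨c, hcC, hc0⟩ := (Submodule.ne_bot_iff _).mp hCne
  refine ⟨c, hc0, fun g => ?_⟩
  have h1 : τ g c - c ∈ C.toSubmodule := C.toSubmodule.sub_mem (C.apply_mem_toSubmodule g hcC) hcC
  have h2 : τ g c - c ∈ LinearMap.ker φ := by
    rw [LinearMap.mem_ker, map_sub, hinv, sub_self]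
  have h3 : τ g c - c ∈ LinearMap.ker φ ⊓ C.toSubmodule := ⟨h2, h1⟩
  rw [hKC'.inf_eq_bot, Submodule.mem_bot, sub_eq_zero] at h3
  exact h3

/-- Complete reducibility is transported along conjugation: if `x H x⁻¹ ⊆ M` and `x⁻¹ M x ⊆ H`
and `τ|_M` is completely reducible, so is `τ|_H` (translate stable subspaces by `τ x`).
[folklore] -/
private theorem isSemisimpleRepresentation_comp_of_conj (τ : Representation ℂ G V)
    {H M : Subgroup G} (x : G) (hHM : ∀ h ∈ H, x * h * x⁻¹ ∈ M)
    (hMH : ∀ m ∈ M, x⁻¹ * m * x ∈ H) (hM : Representation.IsSemisimpleRepresentation (τ.comp M.subtype)) :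
    Representation.IsSemisimpleRepresentation (τ.comp H.subtype) := by
  refine ⟨fun T => ?_⟩
  -- `τ x • T` is `M`-stable
  let TM : Subrepresentation (τ.comp M.subtype) :=
    ⟨T.toSubmodule.map (τ x), fun m y hy => by
      obtain ⟨t, ht, rfl⟩ := hy
      refine ⟨τ (x⁻¹ * m * x) t, T.apply_mem_toSubmodule ⟨_, hMH m m.2⟩ ht, ?_⟩
      change τ x (τ (x⁻¹ * m * x) t) = τ m (τ x t)
      rw [← Module.End.mul_apply, ← map_mul, ← Module.End.mul_apply, ← map_mul]
      congr 1
      group⟩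
  obtain ⟨CM, hc⟩ := hM.exists_isCompl TM
  have hc' := isCompl_toSubmodule_of_isCompl' hc
  -- `τ x⁻¹ • CM` is an `H`-stable complement of `T`
  let C : Subrepresentation (τ.comp H.subtype) :=
    ⟨CM.toSubmodule.map (τ x⁻¹), fun h y hy => by
      obtain ⟨c, hcC, rfl⟩ := hy
      refine ⟨τ (x * h * x⁻¹) c, CM.apply_mem_toSubmodule ⟨_, hHM h h.2⟩ hcC, ?_⟩
      change τ x⁻¹ (τ (x * h * x⁻¹) c) = τ h (τ x⁻¹ c)
      rw [← Module.End.mul_apply, ← map_mul, ← Module.End.mul_apply, ← map_mul]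
      congr 1
      group⟩
  refine ⟨C, isCompl_of_isCompl_toSubmodule' ?_⟩
  -- transport `IsCompl` along the linear automorphism `τ x⁻¹`
  let e : V ≃ₗ[ℂ] V := LinearEquiv.ofLinear (τ x⁻¹) (τ x)
    (by rw [← Module.End.mul_eq_comp, ← map_mul, inv_mul_cancel, map_one]; rfl)
    (by rw [← Module.End.mul_eq_comp, ← map_mul, mul_inv_cancel, map_one]; rfl)
  have hT : T.toSubmodule = (TM.toSubmodule).map (e : V →ₗ[ℂ] V) := by
    change T.toSubmodule = (T.toSubmodule.map (τ x)).map (τ x⁻¹)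
    rw [← Submodule.map_comp, ← Module.End.mul_eq_comp, ← map_mul, inv_mul_cancel, map_one,
      Module.End.one_eq_id, Submodule.map_id]
  have hC : C.toSubmodule = (CM.toSubmodule).map (e : V →ₗ[ℂ] V) := rfl
  rw [hT, hC]
  exact hc'.map (Submodule.orderIsoMapComap e)

end Weyl

/-! ### § 2 Prop. 5.1 as printed -/

section Prop51

variable {σ : Type*} [Fintype σ] [LinearOrder σ]

/-- **Mulmuley–Sohoni 2008, Prop. 5.1** `[tex:cs_0612134 main.tex L1099–1108, \label{pstableorb}]`
(«Let `h ∈ P(V)` be a point such that the stabilizer `H = G_ĥ` of `ĥ ∈ V` is reductive. Then every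
irreducible `G`-module occurring in `R[h]` must be `H`-admissible; i.e., must contain a nonzero
`H`-invariant. If `G_ĥ` is not reductive, this still holds if `H` is any reductive subgroup of
`G_ĥ`.»), in the tree's special case (same vocabulary as the named fact `MS08_thm_1_8a`):
`G = SL_σ(ℂ)` (`slSubgroup`) acting on forms by linear substitution, `h` a form of degree `m`,
`R[h]_d = ℂ[Δ[h]]_d` (`orbitCoordRepDeg h m d`), the `G`-module given as a representation `ρ` of
`GL_σ(ℂ)` restricted to `SL_σ(ℂ)`, «occurring in `R[h]`» = a non-zero `SL`-intertwiner into some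
degree piece, `H` any subgroup of `SL_σ(ℂ) ∩ G_ĥ` (`slSubgroup ⊓ linStabilizer h`), and the
hypothesis «`H` reductive» in the form in which the printed proof uses it («Weyl's theorem on
complete decomposibility of `H`-modules», L1109–1112; Goodman–Wallach Def. 3.3.1: reductive = every
regular representation completely reducible): the `H`-module `ρ|_H` is completely reducible. (So
the statement proved is Prop. 5.1 with the reductivity hypothesis weakened to this instance;
irreducibility of the `G`-module is not needed.) Proof as printed: the evaluation at `ĥ` is a
non-zero `H`-invariant functional on the image (Prop. 4.2: `exists_evalAtPoint_ne_zero`,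
`evalAtPoint_orbitCoordRep_of_eq_smul`), then Weyl's step
(`exists_ne_zero_invariant_of_invariant_functional`).
[cite: MulmuleySohoniGCT2SIAM2008, Prop. 5.1 (arXiv cs/0612134 Prop. 6.1, main.tex L1099–1113)] -/
theorem MS08_prop_5_1 (h : MvPolynomial σ ℂ) {m : ℕ} (hh : h.IsHomogeneous m)
    {H : Subgroup (GL σ ℂ)} (hH : H ≤ slSubgroup σ ℂ ⊓ linStabilizer h)
    {V : Type u} [AddCommGroup V] [Module ℂ V] (ρ : Representation ℂ (GL σ ℂ) V)
    (hss : Representation.IsSemisimpleRepresentation (ρ.comp H.subtype)) {d : ℕ}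
    (ψ : IntertwiningMap (ρ.comp (slSubgroup σ ℂ).subtype)
      ((orbitCoordRepDeg h m d).comp (slSubgroup σ ℂ).subtype)) (hψ : ψ ≠ 0) :
    IsAdmissible ρ H := by
  classical
  -- the pulled-back evaluation functional `φ = ev_ĥ ∘ ψ`
  set φ : V →ₗ[ℂ] ℂ :=
    (evalAtPoint h m).toLinearMap ∘ₗ (orbitCoordRingDeg h m d).subtype ∘ₗ ψ.toLinearMap with hφdef
  have hφapply : ∀ x, φ x =
      evalAtPoint h m ((ψ x : orbitCoordRingDeg h m d) : OrbitCoordRing h m) := fun x => rfl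
  have hinter : ∀ (γ : GL σ ℂ) (hγ : γ ∈ slSubgroup σ ℂ) (x : V),
      ψ (ρ γ x) = orbitCoordRepDeg h m d γ (ψ x) := fun γ hγ x =>
    IntertwiningMap.isIntertwining _ _ ψ ⟨γ, hγ⟩ x
  -- `φ` is `H`-invariant (evaluation at `ĥ` is fixed by the stabiliser of `ĥ`)
  have hφinv : ∀ γ ∈ H, ∀ x, φ (ρ γ x) = φ x := by
    intro γ hγ x
    obtain ⟨hγsl, hγst⟩ := Subgroup.mem_inf.mp (hH hγ)
    have hγf : linSubstRep σ ℂ γ h = (1 : ℂ) • h := by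
      rw [one_smul]; exact mem_linStabilizer.mp hγst
    rw [hφapply, hφapply, hinter γ hγsl x, orbitCoordRepDeg_apply_coe,
      evalAtPoint_orbitCoordRep_of_eq_smul one_ne_zero hγf (ψ x).2, inv_one, one_pow, one_mul]
  -- `φ ≠ 0`: otherwise evaluation vanishes on the `SL`-stable image of `ψ`, which is then zero
  have hφne : φ ≠ 0 := by
    intro hφ0
    apply hψ
    set W' : Submodule ℂ (OrbitCoordRing h m) :=
      (LinearMap.range ψ.toLinearMap).map (orbitCoordRingDeg h m d).subtype with hW'
    have hW'd : W' ≤ orbitCoordRingDeg h m d := by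
      rintro _ ⟨y, _, rfl⟩
      exact y.2
    have hW'G : ∀ γ ∈ slSubgroup σ ℂ, ∀ x ∈ W', orbitCoordRep h m γ x ∈ W' := by
      rintro γ hγ _ ⟨y, ⟨w, rfl⟩, rfl⟩
      refine ⟨orbitCoordRepDeg h m d γ (ψ w), ⟨ρ γ w, ?_⟩, rfl⟩
      rw [IntertwiningMap.toLinearMap_apply, hinter γ hγ w]
    have hW'bot : W' = ⊥ := by
      by_contra hne
      obtain ⟨x, hx, hx0⟩ :=
        exists_evalAtPoint_ne_zero (hasFullProjectiveOrbit_slSubgroup hh) hW'd hW'G hne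
      obtain ⟨y, ⟨w, rfl⟩, rfl⟩ := hx
      apply hx0
      have := LinearMap.congr_fun hφ0 w
      rw [LinearMap.zero_apply] at this
      exact this
    apply IntertwiningMap.ext
    apply LinearMap.ext
    intro w
    have hmem : ((ψ w : orbitCoordRingDeg h m d) : OrbitCoordRing h m) ∈ W' :=
      ⟨ψ w, ⟨w, rfl⟩, rfl⟩
    rw [hW'bot, Submodule.mem_bot] at hmem
    rw [IntertwiningMap.toLinearMap_apply, IntertwiningMap.zero_toLinearMap, LinearMap.zero_apply]
    exact Subtype.ext hmem
  -- Weyl's step on the completely reducible `H`-module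
  obtain ⟨v, hv0, hv⟩ := exists_ne_zero_invariant_of_invariant_functional (ρ.comp H.subtype) hss
    φ hφne (fun g x => hφinv g g.2 x)
  exact isAdmissible_iff_exists.mpr ⟨v, hv0, fun g hg => hv ⟨g, hg⟩⟩

end Prop51

/-! ### § 3 Matsushima's theorem for forms: `SL ∩ G_v̂` is reductive for polystable `v` -/

section Matsushima

variable {σ : Type*} [Fintype σ] [LinearOrder σ]

/-- `SL_σ(ℂ) ≤ GL_σ(ℂ)` is an algebraic subgroup. [folklore] -/
private theorem isAlgebraicSubgroup_slSubgroup : IsAlgebraicSubgroup (slSubgroup σ ℂ) :=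
  isAlgebraicSubgroup_of_mem_iff_det_eq_one fun _ => mem_slSubgroup_iff

/-- The stabiliser `G_w` of a polynomial is an algebraic subgroup of `GL_σ(ℂ)`: it is cut out by
the coefficients of `X · w - w`, polynomials in the matrix entries
(`eval_coeff_genericLinSubst`). [folklore] -/
private theorem isAlgebraicSubgroup_linStabilizer (w : MvPolynomial σ ℂ) :
    IsAlgebraicSubgroup (linStabilizer w) := by
  classical
  refine ⟨Set.range fun d : σ →₀ ℕ => rename Sum.inl (coeff d
    (linSubst σ (MvPolynomial (σ × σ) ℂ) (Matrix.mvPolynomialX σ σ ℂ)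
      (map (C : ℂ →+* MvPolynomial (σ × σ) ℂ) w))) - C (coeff d w), ?_⟩
  ext g
  simp only [SetLike.mem_coe, mem_linStabilizer, linSubstRep_apply, zeroLocusGL, Set.mem_setOf_eq,
    Set.forall_mem_range, map_sub, eval_C, sub_eq_zero]
  rw [MvPolynomial.ext_iff]
  refine forall_congr' fun d => ?_
  rw [eval_rename]
  have : (glCoordFun g ∘ Sum.inl) = fun ij : σ × σ => (g : Matrix σ σ ℂ) ij.1 ij.2 := by
    funext ij; rfl
  rw [this, eval_coeff_genericLinSubst]

/-- `SL_σ(ℂ) ∩ G_w` is an algebraic subgroup of `GL_σ(ℂ)`. [folklore] -/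
private theorem isAlgebraicSubgroup_slSubgroup_inf_linStabilizer (w : MvPolynomial σ ℂ) :
    IsAlgebraicSubgroup (slSubgroup σ ℂ ⊓ linStabilizer w) :=
  isAlgebraicSubgroup_slSubgroup.inf (isAlgebraicSubgroup_linStabilizer w)

/-- If the `SL`-stabiliser of `w` is closed under `h ↦ hᴴ` (as matrices), then
`SL_σ(ℂ) ∩ G_w ≤ GL_σ(ℂ)` is self-adjoint. [folklore] -/
private theorem star_mem_slSubgroup_inf_linStabilizer {w : MvPolynomial σ ℂ}
    (hw : ∀ h : Matrix σ σ ℂ, h.det = 1 → linSubst σ ℂ h w = w → linSubst σ ℂ hᴴ w = w)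
    {g : GL σ ℂ} (hg : g ∈ slSubgroup σ ℂ ⊓ linStabilizer w) :
    star g ∈ slSubgroup σ ℂ ⊓ linStabilizer w := by
  obtain ⟨hsl, hst⟩ := Subgroup.mem_inf.mp hg
  rw [mem_slSubgroup_iff] at hsl
  rw [mem_linStabilizer, linSubstRep_apply] at hst
  refine Subgroup.mem_inf.mpr ⟨?_, ?_⟩
  · rw [mem_slSubgroup_iff]; exact det_star_eq_one hsl
  · rw [mem_linStabilizer, linSubstRep_apply, Units.coe_star, Matrix.star_eq_conjTranspose]
    exact hw _ hsl hst

/-- A rational representation of `GL_σ(ℂ)` restricted to a subgroup `M` has regular matrix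
coefficients in the tree's coordinates `glCoordFun` (`P(g) det(g)^{-r}` is a polynomial in the
entries and `det⁻¹`). [folklore] -/
private theorem exists_eval_glCoordFun_of_isRationalRep {V : Type u} [AddCommGroup V] [Module ℂ V]
    {ρ : Representation ℂ (GL σ ℂ) V} (hρ : IsRationalRep ρ) (M : Subgroup (GL σ ℂ)) :
    ∀ (v : V) (ℓ : Module.Dual ℂ V), ∃ P : MvPolynomial (GLCoord σ) ℂ,
      ∀ g : M, ℓ ((ρ.comp M.subtype) g v) = MvPolynomial.eval (glCoordFun (g : GL σ ℂ)) P := by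
  intro v ℓ
  obtain ⟨P, r, hP⟩ := hρ v ℓ
  refine ⟨rename Sum.inl P * X (Sum.inr ()) ^ r, fun g => ?_⟩
  have hdet : Matrix.det ((g : GL σ ℂ) : Matrix σ σ ℂ) ≠ 0 :=
    ((Matrix.isUnit_iff_isUnit_det _).mp (g : GL σ ℂ).isUnit).ne_zero
  have hcomp : (glCoordFun (g : GL σ ℂ) ∘ Sum.inl) =
      fun ij : σ × σ => ((g : GL σ ℂ) : Matrix σ σ ℂ) ij.1 ij.2 := by
    funext ij; rfl
  rw [map_mul, map_pow, eval_X, Literature.NumberTheory.Automorphic.glCoordFun_inr, eval_rename,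
    hcomp, ← hP g]
  change ℓ (ρ (g : GL σ ℂ) v) = _
  rw [mul_assoc, ← mul_pow, mul_inv_cancel₀ hdet, one_pow, mul_one]

/-- **Matsushima's theorem for forms** (used in Mulmuley–Sohoni 2008, §5: «Since `v` is stable,
the stabilizer `H = G_v̂` is reductive [harish, matsushima]», main.tex L1125–1127, L1169–1171), in
Goodman–Wallach's sense of «reductive» (Def. 3.3.1: every regular representation is completely
reducible): if `v ∈ Sym^m ℂ^σ` is polystable (closed `SL_σ(ℂ)`-orbit), then the restriction to
`SL_σ(ℂ) ∩ G_v̂` of every finite-dimensional rational representation of `GL_σ(ℂ)` is completely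
reducible. Route: Kempf–Ness (`IsPolystable.exists_translate_stabilizer_star_closed`: a translate
`w = g₀ · v` has self-adjoint stabiliser) + the unitarian trick
(`AlgebraicGroups.isSemisimpleRepresentation_of_star_mem`) + conjugation by `g₀`.
[cite: MulmuleySohoniGCT2SIAM2008, §5 (arXiv cs/0612134 §6, main.tex L1125–1127: stabilizers of stable points are reductive, after Matsushima 1960)] -/
theorem isSemisimpleRepresentation_comp_stabilizer_of_isPolystable {v : MvPolynomial σ ℂ} {m : ℕ}
    (hv : v.IsHomogeneous m) (hst : IsPolystable v)
    {V : Type u} [AddCommGroup V] [Module ℂ V] [FiniteDimensional ℂ V]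
    (ρ : Representation ℂ (GL σ ℂ) V) (hρ : IsRationalRep ρ) :
    Representation.IsSemisimpleRepresentation (ρ.comp (slSubgroup σ ℂ ⊓ linStabilizer v).subtype) := by
  classical
  obtain ⟨g₀, hg₀, hw⟩ := hst.exists_translate_stabilizer_star_closed hv
  set w : MvPolynomial σ ℂ := linSubst σ ℂ g₀ v with hwdef
  set M : Subgroup (GL σ ℂ) := slSubgroup σ ℂ ⊓ linStabilizer w with hMdef
  -- `M` is a self-adjoint algebraic subgroup, hence reductive
  have hMss : Representation.IsSemisimpleRepresentation (ρ.comp M.subtype) :=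
    isSemisimpleRepresentation_of_star_mem (isAlgebraicSubgroup_slSubgroup_inf_linStabilizer w)
      (fun _ hg => star_mem_slSubgroup_inf_linStabilizer hw hg) _
      (exists_eval_glCoordFun_of_isRationalRep hρ M)
  -- conjugate back: `SL ∩ G_v = g₀⁻¹ M g₀`
  have hg₀ne : g₀.det ≠ 0 := by rw [hg₀]; exact one_ne_zero
  set G₀ : GL σ ℂ := Matrix.GeneralLinearGroup.mkOfDetNeZero g₀ hg₀ne with hG₀def
  have hG₀val : (G₀ : Matrix σ σ ℂ) = g₀ := rfl
  have hG₀sl : G₀ ∈ slSubgroup σ ℂ := by rw [mem_slSubgroup_iff, hG₀val, hg₀]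
  have hwG₀ : w = linSubstRep σ ℂ G₀ v := by rw [linSubstRep_apply, hG₀val]
  refine isSemisimpleRepresentation_comp_of_conj ρ G₀ (fun h hh => ?_) (fun g hg => ?_) hMss
  · obtain ⟨hsl, hstab⟩ := Subgroup.mem_inf.mp hh
    refine Subgroup.mem_inf.mpr ⟨(slSubgroup σ ℂ).mul_mem ((slSubgroup σ ℂ).mul_mem hG₀sl hsl)
      ((slSubgroup σ ℂ).inv_mem hG₀sl), ?_⟩
    rw [mem_linStabilizer] at hstab ⊢
    rw [hwG₀, map_mul, map_mul, Module.End.mul_apply, Module.End.mul_apply,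
      ← Module.End.mul_apply (linSubstRep σ ℂ G₀⁻¹), ← map_mul, inv_mul_cancel, map_one,
      Module.End.one_apply, hstab]
  · obtain ⟨hsl, hstab⟩ := Subgroup.mem_inf.mp hg
    refine Subgroup.mem_inf.mpr ⟨(slSubgroup σ ℂ).mul_mem ((slSubgroup σ ℂ).mul_mem
      ((slSubgroup σ ℂ).inv_mem hG₀sl) hsl) hG₀sl, ?_⟩
    rw [mem_linStabilizer] at hstab ⊢
    rw [hwG₀] at hstab
    rw [map_mul, map_mul, Module.End.mul_apply, Module.End.mul_apply, hstab,
      ← Module.End.mul_apply (linSubstRep σ ℂ G₀⁻¹), ← map_mul, inv_mul_cancel, map_one,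
      Module.End.one_apply]

end Matsushima

/-! ### § 4 The «only if» half of Thm. 1.8 (a), and the reduction of the named fact to Prop. 5.2 -/

section Thm18a

open Literature.NumberTheory.DiophantineGeometry in
/-- **Mulmuley–Sohoni 2008, Thm. 1.8 (a), «only if» half** `[tex:cs_0612134 main.tex L478–487]`
(«If `v ∈ P(V)` is stable, an irreducible `G`-module `V_λ(G)` with weight `λ` can occur in
`R_V[v]` [ONLY IF] `V_λ(G)` is `G_v̂`-admissible»; printed proof L1169–1173: «Since `v ∈ P(V)` is
stable, `G_v̂` is reductive [harish, matsushima]. Hence this follows from Proposition 5.1»),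
PROVED in exactly the special case and binders of the named fact `MS08_thm_1_8a` (`G = SL_σ(ℂ)`,
`V = Sym^m ℂ^σ`, `v` a non-zero polystable form of degree `m > 0`, `ρ` a rational representation
of `GL_σ(ℂ)` irreducible on `SL_σ(ℂ)`): Matsushima for forms
(`isSemisimpleRepresentation_comp_stabilizer_of_isPolystable`) + Prop. 5.1 (`MS08_prop_5_1`). The
«if» half (Prop. 5.2) — hence the fact `MS08_thm_1_8a` itself — remains open in the tree.
[cite: MulmuleySohoniGCT2SIAM2008, Thm. 1.8 (a) only-if (arXiv cs/0612134 Thm. 2.8 (a); main.tex L478–487, L1169–1173)] -/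
theorem MS08_thm_1_8a_mp {σ : Type} [Fintype σ] [LinearOrder σ] (v : MvPolynomial σ ℂ) {m : ℕ}
    (_hm : 0 < m) (hv : v.IsHomogeneous m) (_hv0 : v ≠ 0) (hst : IsPolystable v)
    {V : Type} [AddCommGroup V] [Module ℂ V] [FiniteDimensional ℂ V]
    (ρ : Representation ℂ (GL σ ℂ) V) (hρ : IsRationalRep ρ)
    (_hirr : Representation.IsIrreducible (ρ.comp (slSubgroup σ ℂ).subtype))
    (hocc : ∃ d : ℕ, ∃ ψ : IntertwiningMap (ρ.comp (slSubgroup σ ℂ).subtype)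
        ((orbitCoordRepDeg v m d).comp (slSubgroup σ ℂ).subtype), ψ ≠ 0) :
    IsAdmissible ρ (slSubgroup σ ℂ ⊓ linStabilizer v) := by
  obtain ⟨d, ψ, hψ⟩ := hocc
  exact MS08_prop_5_1 v hv le_rfl ρ
    (isSemisimpleRepresentation_comp_stabilizer_of_isPolystable hv hst ρ hρ) ψ hψ

open Literature.NumberTheory.DiophantineGeometry in
/-- Bookkeeping for the named fact: with the «only if» half proved (`MS08_thm_1_8a_mp`),
`MS08_thm_1_8a` follows from — indeed is equivalent to — its «if» half, Prop. 5.2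
(`[L1119–1123]`: «Suppose `h ∈ P(V)` is stable. Then every `H`-admissible, irreducible `G`-module
occurs in `R[h]`»; printed proof: `G ĥ ≅ G/H` closed, algebraic Peter–Weyl, L1124–1168), stated
here as a HYPOTHESIS in the binders of the fact (the converse projection is the tree's
`MS08_prop_5_2_of_thm_1_8a`). No named fact is introduced for Prop. 5.2.
[cite: MulmuleySohoniGCT2SIAM2008, Thm. 1.8 (a) proof (arXiv cs/0612134 Thm. 2.8 (a); main.tex L1169–1173)] -/
theorem MS08_thm_1_8a_of_prop_5_2
    (h52 : ∀ {σ : Type} [Fintype σ] [LinearOrder σ] (v : MvPolynomial σ ℂ) {m : ℕ} (_ : 0 < m)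
      (_ : v.IsHomogeneous m) (_ : v ≠ 0) (_ : IsPolystable v)
      {V : Type} [AddCommGroup V] [Module ℂ V] [FiniteDimensional ℂ V]
      (ρ : Representation ℂ (GL σ ℂ) V) (_ : IsRationalRep ρ)
      (_ : Representation.IsIrreducible (ρ.comp (slSubgroup σ ℂ).subtype)),
      IsAdmissible ρ (slSubgroup σ ℂ ⊓ linStabilizer v) →
      ∃ d : ℕ, ∃ ψ : IntertwiningMap (ρ.comp (slSubgroup σ ℂ).subtype)
        ((orbitCoordRepDeg v m d).comp (slSubgroup σ ℂ).subtype), ψ ≠ 0) :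
    MS08_thm_1_8a :=
  fun v _ hm hv hv0 hst _ _ _ _ ρ hρ hirr =>
    ⟨MS08_thm_1_8a_mp v hm hv hv0 hst ρ hρ hirr, h52 v hm hv hv0 hst ρ hρ hirr⟩

end Thm18a

end Literature.Computability.AlgebraicComplexity

end
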